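import Literature.MathematicalPhysics.QuantumFieldTheory.MullerSchiemann1987.MS87WilsonAction
import Literature.Analysis.Matrix.ExpAbsKernel
import HarnessLib

/-!
# Müller–Schiemann, *Continuum limit of a hierarchical SU(2) lattice gauge theory in 4 dimensions*
# (CMP 110, 1987), p.263 L.34–35 with (2.5) p.264: THE WILSON GIBBS FACTOR `g_W = exp{β(trace u − 2)}` IS OF
# POSITIVE TYPE (`g_W ∈ 𝒢₀` of p.283) — the structural input of Theorem 3 at the initial scale, PROVED
# (theorems only; no definition, no named fact)

statement-level skeleton of published theorems with citation tags; proofs where landed; nothing here is a claim about the Yang–Mills mass gap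

**Citation header (reproduction of PUBLISHED work).** V. F. Müller, J. Schiemann, *Continuum limit of a hierarchical
SU(2) lattice gauge theory in 4 dimensions*, Commun. Math. Phys. **110** (1987) 261–286, doi 10.1007/BF01207367
[MullerSchiemann1987]; p.263 L.29–35 (the Gibbs factors `g⁽ⁿ⁾`, (2.1)–(2.3), «Usually g⁽⁰⁾(u) is chosen as a function
of positive type; this property iterates too, see (I).»), (2.5) p.264 (the Wilson action `g⁽⁰⁾(u) = exp{β(trace u − 2)}`),
p.283 L.26–28 («𝒢 := {g(u) continuous class function on G, g(u) ≥ 0, g(e₀) = 1}, and (ii) 𝒯 is injective on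
𝒢₀ := {g ∈ 𝒢, g is of positive type}»), Theorem 3 p.282 (stated «for the initial Wilson and heat kernel action»).
Held Project Euclid scan `paper:url-96df5da18d4c` (renders `run/shared/lean/pub/lit-balaban/lit-balaban-p12/
renders-cmp110ms/ms87-cmp110-pdfp003-journalp263-x3.png`, `…pdfp023-journalp283-x3.png`). The kernel facts used are
Berg–Christensen–Ressel, *Harmonic Analysis on Semigroups* (GTM 100, 1984) Ch. 3 §1.9, §1.11, Cor. 1.14
[BergChristensenRessel1984] = the tree's `isPosDefKernel_mul_fun`, `isPosDefKernel_finsetSum`, `IsPosDefKernel.const_mul`,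
`IsPosDefKernel.exp` (`Literature.Analysis.Matrix.SchoenbergKernelsProofs`) and `IsPosDefKernel.comp` (`ExpAbsKernel`).
Lean lane of the lit-balaban YM LIT SWEEP CONTEXT row X1 (register level; zero weight for any token of that table); the
model is the `d = 4` HIERARCHICAL `SU(2)` gauge model, NOT lattice Yang–Mills.

**What this file proves (kernel-checked, 0 sorry).** «`f` is of positive type» is rendered, as in the siblings
`MS87PositiveTypeIterates` / `MS87Theorem3Climb`, by: the kernel `(u, v) ↦ f(u⁻¹v)` is an `IsPosDefKernel`.
* §1 for complex matrices of any finite shape, **`(A, B) ↦ Re trace(Aᴴ B) = Σ_{ij} (Re A_{ij} Re B_{ij} + Im A_{ij} Im B_{ij})`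
  is a positive definite kernel** (a finite sum of Gram kernels `f(A) f(B)`; `isPosDefKernel_re_trace_conjTranspose_mul`).
* §2 on `SU(n) = Matrix.specialUnitaryGroup n ℂ` (`u⁻¹ = u*`): **`u ↦ Re trace u` is of positive type**
  (`isPosDefKernel_re_trace_inv_mul`) and hence so is **`u ↦ exp{β Re trace u}` for every `β ≥ 0`**
  (`isPosDefKernel_exp_mul_re_trace_inv_mul`; Schur products / BCR Cor. 3.1.14) — the general form of the next item.
* §3 `G = SU(2)` in the paper's coordinates (`trace u = 2u₀`, the sibling `HeatKernel.u0`): **`u ↦ u₀(u)` is of positive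
  type** (`isPosDefKernel_u0_inv_mul`) and **the Wilson Gibbs factor (2.5) `g_W(u) = exp{2β(u₀ − 1)} = exp{β(trace u − 2)}`
  is of positive type for every `β ≥ 0`** (`positiveType_gW`), i.e. `g_W ∈ 𝒢₀` together with the sibling
  `WilsonAction.inG_gW` / `isSymm_gW`; bundled for cutoff families `g_N^{(−N)} = g_W(β_N)`, `β_N ≥ 0`, as the hypotheses
  `hinit` / `hpos` of the siblings `Theorem3InitialData.theorem3_climb_initial` and `MigdalInjective` (`wilson_initial_data`).

**Readings / scope (declared).** (i) The paper asserts positive type of the initial factor only through the sentence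
p.263 L.34–35 and the definition of `𝒢₀` p.283 used by Theorem 3 «for the initial Wilson and heat kernel action»; the
proof here (Gram form of `Re trace(u*v)` + Schur/BCR) is the standard one and is ours. (ii) `β ≥ 0` is needed (`β < 0`
is not of positive type in general) — the paper's bare couplings (1.4) are positive. (iii) The heat-kernel initial
factor (2.20) is NOT treated here (its positive type is the positive type of the characters `χ_j`, i.e. Peter–Weyl for
`SU(2)`, not in the tree). Nothing about lattice Yang–Mills.
-/

noncomputable section

open scoped BigOperators

namespace Literature.MathematicalPhysics.QuantumFieldTheory

namespace MullerSchiemann1987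

namespace WilsonAction

open Literature.Analysis.Matrix (IsPosDefKernel isPosDefKernel_mul_fun isPosDefKernel_finsetSum)
open Migdal (InG IsSymm)
open HeatKernel (u0 trace_re_div_two)

/-! ## §1 `Re trace(Aᴴ B)` is a positive definite kernel on complex matrices -/

section Matrices

variable {m n : Type*} [Fintype m] [Fintype n]

/-- `Re trace(Aᴴ B) = Σ_i Σ_j (Re A_{ji} Re B_{ji} + Im A_{ji} Im B_{ji})` (plumbing). [folklore] -/
private theorem re_trace_conjTranspose_mul (A B : Matrix m n ℂ) :
    ((A.conjTranspose * B).trace).re =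
      ∑ i, ∑ j, ((A j i).re * (B j i).re + (A j i).im * (B j i).im) := by
  simp only [Matrix.trace, Matrix.diag_apply, Matrix.mul_apply, Matrix.conjTranspose_apply, Complex.re_sum,
    Complex.mul_re, Complex.star_def, Complex.conj_re, Complex.conj_im, neg_mul, sub_neg_eq_add]

/-- **The Hilbert–Schmidt kernel `(A, B) ↦ Re trace(Aᴴ B)` on complex `m × n` matrices is positive definite**: it is
the finite sum over the entries of the Gram kernels `Re A_{ij} · Re B_{ij}` and `Im A_{ij} · Im B_{ij}` (BCR 3.1.9), and
positive definite kernels form a convex cone (BCR 3.1.11).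
[cite: BergChristensenRessel1984, Ch. 3 §1.9 and §1.11 (PDF p. 70)] -/
theorem isPosDefKernel_re_trace_conjTranspose_mul :
    IsPosDefKernel fun A B : Matrix m n ℂ => ((A.conjTranspose * B).trace).re := by
  have e : (fun A B : Matrix m n ℂ => ((A.conjTranspose * B).trace).re) = fun A B =>
      ∑ i, ∑ j, ((fun M : Matrix m n ℂ => (M j i).re) A * (fun M : Matrix m n ℂ => (M j i).re) B +
        (fun M : Matrix m n ℂ => (M j i).im) A * (fun M : Matrix m n ℂ => (M j i).im) B) := by
    funext A B
    exact re_trace_conjTranspose_mul A B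
  rw [e]
  exact isPosDefKernel_finsetSum _ fun i _ => isPosDefKernel_finsetSum _ fun j _ =>
    (isPosDefKernel_mul_fun _).add (isPosDefKernel_mul_fun _)

end Matrices

/-! ## §2 `SU(n)`: `Re trace u` and `exp{β Re trace u}` are of positive type -/

section SUn

variable {n : Type*} [Fintype n] [DecidableEq n]

/-- In `SU(n)`, `u⁻¹v = u* v` as matrices (plumbing). [folklore] -/
private theorem coe_inv_mul (U V : Matrix.specialUnitaryGroup n ℂ) :
    ((U⁻¹ * V : Matrix.specialUnitaryGroup n ℂ) : Matrix n n ℂ) =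
      (U : Matrix n n ℂ).conjTranspose * (V : Matrix n n ℂ) := by
  rw [Submonoid.coe_mul, ← Matrix.star_eq_inv, Matrix.specialUnitaryGroup.coe_star, Matrix.star_eq_conjTranspose]

/-- **`u ↦ Re trace u` is of positive type on `SU(n)`**: the kernel `(u, v) ↦ Re trace(u⁻¹v) = Re trace(u* v)` is the
Hilbert–Schmidt Gram kernel of §1 pulled back to the group (BCR 3.1.9/3.1.11; for `n = 2` this is `2u₀(u⁻¹v)`, §3).
[cite: BergChristensenRessel1984, Ch. 3 §1.9 and §1.11 (PDF p. 70); MullerSchiemann1987, p.283 L.26–28 («𝒢₀»)] -/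
theorem isPosDefKernel_re_trace_inv_mul :
    IsPosDefKernel fun U V : Matrix.specialUnitaryGroup n ℂ =>
      (((U⁻¹ * V : Matrix.specialUnitaryGroup n ℂ) : Matrix n n ℂ).trace).re := by
  have e : (fun U V : Matrix.specialUnitaryGroup n ℂ =>
      (((U⁻¹ * V : Matrix.specialUnitaryGroup n ℂ) : Matrix n n ℂ).trace).re) =
      fun U V : Matrix.specialUnitaryGroup n ℂ =>
        (((U : Matrix n n ℂ).conjTranspose * (V : Matrix n n ℂ)).trace).re := by
    funext U V
    rw [coe_inv_mul]
  rw [e]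
  exact isPosDefKernel_re_trace_conjTranspose_mul.comp fun U : Matrix.specialUnitaryGroup n ℂ => (U : Matrix n n ℂ)

/-- **The `SU(n)` Wilson Gibbs factor `u ↦ exp{β Re trace u}` is of positive type for `β ≥ 0`** (general form of
(2.5)/p.263 L.34–35: a nonnegative multiple of a positive definite kernel is positive definite, and so is its
exponential — BCR 3.1.11, Cor. 3.1.14 (Schur)).
[cite: BergChristensenRessel1984, Ch. 3 Cor. 1.14 (PDF p. 71); MullerSchiemann1987, p.263 L.34–35, (2.5) p.264] -/
theorem isPosDefKernel_exp_mul_re_trace_inv_mul {β : ℝ} (hβ : 0 ≤ β) :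
    IsPosDefKernel fun U V : Matrix.specialUnitaryGroup n ℂ =>
      Real.exp (β * (((U⁻¹ * V : Matrix.specialUnitaryGroup n ℂ) : Matrix n n ℂ).trace).re) :=
  (isPosDefKernel_re_trace_inv_mul.const_mul hβ).exp

end SUn

/-! ## §3 `G = SU(2)`: `u₀` and the Wilson Gibbs factor (2.5) are of positive type -/

section SU2

/-- `u₀(u⁻¹v) = ½ Re trace(u⁻¹v)` (`trace u = 2u₀`, the sibling `HeatKernel.trace_re_div_two`).
[cite: MullerSchiemann1987, p.264 L.28–30, (2.5) p.264] -/
theorem u0_inv_mul_eq (U V : Matrix.specialUnitaryGroup (Fin 2) ℂ) :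
    u0 (U⁻¹ * V) =
      (1 / 2 : ℝ) * (((U⁻¹ * V : Matrix.specialUnitaryGroup (Fin 2) ℂ) : Matrix (Fin 2) (Fin 2) ℂ).trace).re := by
  rw [← trace_re_div_two (U⁻¹ * V)]
  ring

/-- **`u ↦ u₀(u) = ½ trace u` is of positive type on `SU(2)`**: the kernel `(u, v) ↦ u₀(u⁻¹v)` is positive definite
(half the Hilbert–Schmidt Gram kernel `Re trace(u* v)`).
[cite: MullerSchiemann1987, p.263 L.34–35, p.283 L.26–28; BergChristensenRessel1984, Ch. 3 §1.9 and §1.11 (PDF p. 70)] -/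
theorem isPosDefKernel_u0_inv_mul :
    IsPosDefKernel fun U V : Matrix.specialUnitaryGroup (Fin 2) ℂ => u0 (U⁻¹ * V) := by
  have e : (fun U V : Matrix.specialUnitaryGroup (Fin 2) ℂ => u0 (U⁻¹ * V)) = fun U V =>
      (1 / 2 : ℝ) * (((U⁻¹ * V : Matrix.specialUnitaryGroup (Fin 2) ℂ) : Matrix (Fin 2) (Fin 2) ℂ).trace).re := by
    funext U V
    exact u0_inv_mul_eq U V
  rw [e]
  exact isPosDefKernel_re_trace_inv_mul.const_mul (by norm_num)

/-- **The Wilson Gibbs factor (2.5), `g_W(u) = exp{2β(u₀ − 1)} = exp{β(trace u − 2)}`, is of positive type for every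
`β ≥ 0`**: `g_W(u⁻¹v) = e^{−2β} · exp{2β u₀(u⁻¹v)}` with `u₀(u⁻¹v)` positive definite, so Schur's theorem / BCR
Cor. 3.1.14 and the cone property apply («Usually g⁽⁰⁾(u) is chosen as a function of positive type», p.263; i.e.
`g_W ∈ 𝒢₀` of p.283 together with the sibling `inG_gW`).
[cite: MullerSchiemann1987, p.263 L.34–35, (2.5) p.264, p.283 L.26–28; BergChristensenRessel1984, Ch. 3 Cor. 1.14 (PDF p. 71)] -/
theorem positiveType_gW {β : ℝ} (hβ : 0 ≤ β) :
    IsPosDefKernel fun U V : Matrix.specialUnitaryGroup (Fin 2) ℂ => Real.exp (2 * β * (u0 (U⁻¹ * V) - 1)) := by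
  have e : (fun U V : Matrix.specialUnitaryGroup (Fin 2) ℂ => Real.exp (2 * β * (u0 (U⁻¹ * V) - 1))) =
      fun U V => Real.exp (-(2 * β)) * Real.exp (2 * β * u0 (U⁻¹ * V)) := by
    funext U V
    rw [← Real.exp_add]
    congr 1
    ring
  rw [e]
  exact ((isPosDefKernel_u0_inv_mul.const_mul (by positivity)).exp).const_mul (Real.exp_pos _).le

/-- **The Wilson initial data of Theorem 3 are in `𝒢₀`**: for a family of cutoff models whose INITIAL Gibbs factor
at cutoff `N` is the Wilson factor (2.5) with bare coupling `β_N ≥ 0`, `g_N^{(−N)} = g_W(β_N)`, every `g_N^{(−N)}`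
lies in `𝒢` (sibling `inG_gW`), is symmetric ((2.3), sibling `isSymm_gW`) and is of positive type (`positiveType_gW`)
— exactly the structural hypotheses `hinit`, `hpos` of the siblings `Theorem3InitialData.theorem3_climb_initial` /
`MigdalInjective` for «the initial Wilson … action» of Theorem 3.
[cite: MullerSchiemann1987, Thm 3 p.282, (2.5) p.264, p.263 L.29–35, p.283 L.26–28] -/
theorem wilson_initial_data {βN : ℕ → ℝ} (hβ : ∀ N, 0 ≤ βN N)
    {g : ℕ → ℕ → Matrix.specialUnitaryGroup (Fin 2) ℂ → ℝ}
    (hW : ∀ N, g N N = fun U => Real.exp (2 * βN N * (u0 U - 1))) :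
    (∀ N, InG (g N N)) ∧ (∀ N, IsSymm (g N N)) ∧
      ∀ N, IsPosDefKernel fun u v : Matrix.specialUnitaryGroup (Fin 2) ℂ => g N N (u⁻¹ * v) := by
  refine ⟨fun N => ?_, fun N => ?_, fun N => ?_⟩
  · rw [hW N]; exact inG_gW (βN N)
  · rw [hW N]; exact isSymm_gW (βN N)
  · simp only [hW N]; exact positiveType_gW (hβ N)

end SU2

end WilsonAction

end MullerSchiemann1987

end Literature.MathematicalPhysics.QuantumFieldTheory
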